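import Literature.NumberTheory.Transcendental.KZCubicalCalculus
import Summits.KontsevichZagierPeriods.KontsevichZagierPeriods.Theorems.UnfoldedStokesStokesGenerationStubRungValue
import Mathlib.MeasureTheory.Integral.Pi

/-!
# `StokesGeneration` (stmt-KontsevichZagierPeriods-3586), line `fibrewise_stokes`, stub `stub_valueOneCoord` (rung 9, V7)

The registered stub `stub_valueOneCoord` of the line `Cruxes/StokesGeneration/Lines/fibrewise_stokes.lean`
(rung 9, separated-variables integrands `Σⱼ γⱼ fⱼ(x_{aⱼ})` on `[0,1]^N`; this is the one-coordinate
case): if `t : IntegralRep N` has domain the closed unit cube `[0,1]^N = Set.pi univ (fun _ => [0,1])`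
and its integrand agrees on the cube with a function `x ↦ g (x a)` of ONE coordinate `a : Fin N`, with
`g` continuous on `[0,1]`, then `t.value = ∫₀¹ g`.

Proof (Fubini on the unit cube): Lebesgue measure restricted to the cube is the product of `N` copies
of the probability measure `volume.restrict [0,1]` (`MeasureTheory.volume_pi`,
`MeasureTheory.Measure.restrict_pi_pi`, `Real.volume_Icc`), and evaluation at the coordinate `a` is
measure preserving from this product to `volume.restrict [0,1]` — the coordinates other than `a`
carry total mass `1` (`MeasureTheory.measurePreserving_eval`, used through
`MeasureTheory.integral_comp_eval`). Finally `∫_{[0,1]} g = ∫₀¹ g` (`integral_Icc_eq_integral_Ioc`,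
`intervalIntegral.integral_of_le`). [Kontsevich–Zagier 2001, §1.2 (Fubini)]
-/

noncomputable section

set_option linter.dupNamespace false

namespace Summit.KontsevichZagierPeriods.KontsevichZagierPeriods.Cruxes.StokesGeneration.FibrewiseStokes

open MeasureTheory Set
open Literature.NumberTheory.Transcendental
open Literature.NumberTheory.Transcendental.KZ

/-- Lebesgue measure restricted to `[0,1]` is a probability measure (`volume [0,1] = 1`). [folklore] -/
theorem isProbabilityMeasure_volume_restrict_unitIcc :
    IsProbabilityMeasure ((volume : Measure ℝ).restrict (Set.Icc (0:ℝ) 1)) :=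
  ⟨by rw [Measure.restrict_apply_univ, Real.volume_Icc, sub_zero, ENNReal.ofReal_one]⟩

/-- Lebesgue measure on `ℝ^N = (Fin N → ℝ)` restricted to the cube `[0,1]^N` is the product of `N`
copies of Lebesgue measure restricted to `[0,1]`. [folklore] -/
theorem volume_restrict_cubePi (N : ℕ) :
    (volume : Measure (Fin N → ℝ)).restrict (Set.pi Set.univ (fun _ : Fin N => Set.Icc (0:ℝ) 1)) =
      Measure.pi (fun _ : Fin N => (volume : Measure ℝ).restrict (Set.Icc (0:ℝ) 1)) := by
  rw [volume_pi]
  exact Measure.restrict_pi_pi _ _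

/-- **Fubini on the unit cube, one coordinate.** For `g` a.e.-strongly measurable on `[0,1]` and any
coordinate `a : Fin N`, `∫_{[0,1]^N} g (x a) dx = ∫_{[0,1]} g (y) dy`: evaluation at `a` is measure
preserving from `[0,1]^N` to `[0,1]` (the other coordinates carry total mass `1`). [folklore] -/
theorem setIntegral_cubePi_comp_eval {N : ℕ} (a : Fin N) {g : ℝ → ℝ}
    (hg : AEStronglyMeasurable g ((volume : Measure ℝ).restrict (Set.Icc (0:ℝ) 1))) :
    ∫ x in Set.pi Set.univ (fun _ : Fin N => Set.Icc (0:ℝ) 1), g (x a) =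
      ∫ y in Set.Icc (0:ℝ) 1, g y := by
  haveI := isProbabilityMeasure_volume_restrict_unitIcc
  rw [volume_restrict_cubePi]
  exact integral_comp_eval (μ := fun _ : Fin N => (volume : Measure ℝ).restrict (Set.Icc (0:ℝ) 1)) hg

/-- **Fubini on the unit cube, one coordinate, continuous case, as an interval integral.** For `g`
continuous on `[0,1]` and any coordinate `a : Fin N`, `∫_{[0,1]^N} g (x a) dx = ∫₀¹ g`. [folklore] -/
theorem setIntegral_cubePi_comp_eval_eq_intervalIntegral {N : ℕ} (a : Fin N) {g : ℝ → ℝ}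
    (hg : ContinuousOn g (Set.Icc (0:ℝ) 1)) :
    ∫ x in Set.pi Set.univ (fun _ : Fin N => Set.Icc (0:ℝ) 1), g (x a) = ∫ u in (0:ℝ)..1, g u := by
  rw [setIntegral_cubePi_comp_eval a (hg.aestronglyMeasurable measurableSet_Icc),
    integral_Icc_eq_integral_Ioc, intervalIntegral.integral_of_le zero_le_one]

/-- STUB (rung 9, V7) **value of a one-coordinate cube representation**: if `t : IntegralRep N` has
domain the closed unit cube `[0,1]^N` and integrand agreeing there with `x ↦ g (x a)` for one
coordinate `a : Fin N` and `g` continuous on `[0,1]`, then `t.value = ∫₀¹ g` (Fubini on the unit cube: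
the coordinates other than `a` carry total mass `1`). [cite: KontsevichZagier2001, §1.2] -/
theorem stub_valueOneCoord :
    ∀ (N : ℕ) (a : Fin N) (g : ℝ → ℝ), ContinuousOn g (Set.Icc (0:ℝ) 1) →
      ∀ (t : IntegralRep N), t.domain = Set.pi Set.univ (fun _ : Fin N => Set.Icc (0:ℝ) 1) →
      (∀ x ∈ Set.pi Set.univ (fun _ : Fin N => Set.Icc (0:ℝ) 1), t.integrand x = g (x a)) →
      t.value = ∫ u in (0:ℝ)..1, g u := by
  intro N a g hg t ht hti
  have hmeas : MeasurableSet (Set.pi Set.univ (fun _ : Fin N => Set.Icc (0:ℝ) 1)) :=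
    MeasurableSet.univ_pi fun _ => measurableSet_Icc
  rw [IntegralRep.value, ht, setIntegral_congr_fun hmeas hti]
  exact setIntegral_cubePi_comp_eval_eq_intervalIntegral a hg

end Summit.KontsevichZagierPeriods.KontsevichZagierPeriods.Cruxes.StokesGeneration.FibrewiseStokes

end
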